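import Mathlib
import Summits.ValiantsHypothesis.ValiantsHypothesis.Theses.ProjectionRigidity
import Literature.Computability.AlgebraicComplexity.DetReprEquivalent
import Summits.ValiantsHypothesis.ValiantsHypothesis.Theorems.ProjectionRigidityProjOptimalUniqueStubPdcPerThree
import Summits.ValiantsHypothesis.ValiantsHypothesis.Theorems.ProjectionRigidityProjOptimalUniqueStubPivotThree
import Summits.ValiantsHypothesis.ValiantsHypothesis.Theorems.ProjectionRigidityProjOptimalUniqueStubTwoLineThree

/-!
# Skeleton (lead reshape r3; stubs 0, TL@3, PV@3 closed) for crux `ProjectionRigidity.ProjOptimalUnique`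
# (stmt-ValiantsHypothesis-16001, route-ValiantsHypothesis-ProjectionRigidity; line `registered` = BC3 birth)

Crux decl, BY NAME: `Summit.ValiantsHypothesis.ValiantsHypothesis.Theses.ProjectionRigidity.ProjOptimalUnique`:
for every `n ≥ 3`, any two `m × m` VALIANT PROJECTION matrices `A, B` (every entry `X v` or `C c`) with
`det A = det B = per_n` at the optimal size `m = pdc(per_n) = detProjectionComplexity (perPoly (Fin n) ℂ)`
lie in ONE orbit of `GL_m(ℂ) × GL_m(ℂ) × G_per × ⟨transpose⟩`; the conclusion is by `rfl` the body of
`Literature.Computability.AlgebraicComplexity.DetReprEquivalent (permSymmetrySubst ℂ n) A B`.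

## The line (unchanged idea): ACYCLIC (branching-program) NORMAL FORM + NISAN LAYER-UNIQUENESS,
## reshaped by the lead (r1, 2026-08-17) to ISOLATE THE ONLY TESTABLE INSTANCE `n = 3`.

An `m × m` projection `N` is in ACYCLIC FORM (vertex `0` = merged source/sink) when `N i j = 0` for
`0 < j < i` (as naturals) and the loops `N i i`, `0 < i`, are constants; then `det N` is a signed branching
program with source = sink = `0` (Grenet's `2^n − 1` matrices have this shape).

Why reshape.  Both birth stubs quantify over `n ≥ 3` at the size `pdc(per_n)`, which is UNKNOWN for every
`n ≥ 4`; the only instance where anything can be tested, refuted or anchored is `n = 3`, where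
`pdc(per_3) = 7` is PROVABLE from the tree (lower bound: Alper–Bogart–Velasco, assembled exactly as in the
route's `closes` from `AlperBogartVelascoSubspace/BoxThree` + `determinantalComplexity_le_detProjectionComplexity_holds`;
upper bound: Grenet's explicit `7 × 7` projection, Hüttenhain–Ikenmeyer 2016 eq. (4)).  So the skeleton now
reads: `stub_pdcPerThree` (the anchor, provable now) transports the `n = 3` case to honest `Fin 7` matrices,
where `stub_acyclicNormalFormThree` + `stub_nisanLayerUniqueThree` are the two birth stubs AT `n = 3`
(decidable in principle: enumeration of `7 × 7` patterns with symbolic constants — the route's own cheapest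
falsifier / KILL CRITERION, run by the lead as a kit job); `stub_acyclicNormalForm` + `stub_nisanLayerUnique`
keep the birth statements for `n ≥ 4`.  Five stubs (≤ stubs_max = 7), same composition idea, two `n`-ranges.

* `stub_pdcPerThree` (anchor; size M; PROVABLE NOW): `detProjectionComplexity (perPoly (Fin 3) ℂ) = 7`.
* `stub_acyclicNormalFormThree` (structure at `n = 3`; open, decidable by computation): every `7 × 7`
  projection `A` with `det A = per_3` is `DetReprEquivalent (permSymmetrySubst ℂ 3)`-equivalent to an
  acyclic-form projection `N` with `det N = per_3`.
* `stub_nisanLayerUniqueThree` (rigidity at `n = 3`; open, decidable by computation; HELD BY THE LEAD): any two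
  acyclic-form `7 × 7` projections with `det = per_3` are equivalent.  HI16 Prop. 9 is the binary
  (`0/1`-constants) case of the conjunction of the two `n = 3` stubs; complex constants are open.
* `stub_acyclicNormalForm` (structure, `n ≥ 4`; open, size L–XL) and `stub_nisanLayerUnique` (rigidity,
  `n ≥ 4`; open, size XL): the birth stubs verbatim with `3` replaced by `4` in the range.

COMPOSITION `ProjOptimalUnique_of` (kernel-checked, no sorry): split `n = 3 ∨ 4 ≤ n`; at `n = 3`
`generalize` the size `pdc(per_3)`, rewrite it to `7` by `stub_pdcPerThree`, `subst`, and chain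
`A ~ N ~ N' ~ B` (stubs Three-1, Three-2, `.trans/.symm` of `DetReprEquivalent`); at `n ≥ 4` the birth
chain with the `n ≥ 4` stubs.  `ProjOptimalUnique_proof` ties the sorried copies to the `Stmt` copies.

**Disproof used.** None exists yet (`Cruxes/ProjOptimalUnique/` has no `Disproof.lean`, no `Negative/`, 2026-08-17).
Facts used in the reshape: ABV 2015 Prop. 2.1 (every determinantal expression of `per_3` has constant part of
rank exactly `m − 1` — so no rank-drop invariant can separate orbits; recorded for the disprover), HI16 Prop. 9.
-/

namespace Summit.ValiantsHypothesis.ValiantsHypothesis.Cruxes.ProjOptimalUnique.Birth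

open MvPolynomial Matrix
open Literature.Computability.AlgebraicComplexity
open Summit.ValiantsHypothesis.ValiantsHypothesis.Theses.ProjectionRigidity

set_option linter.dupNamespace false

noncomputable section

/-! ## The seven stub statements (r3: stub 2@3 split as two-line lemma + pivot lemma + rigidity given them) -/

/-- STUB 0 — THE ANCHOR `pdc(per_3) = 7` (Alper–Bogart–Velasco 2017 Cor. 1.4 for the lower bound, in tree;
Grenet 2011 / Hüttenhain–Ikenmeyer 2016 eq. (4) for the explicit `7 × 7` projection).  Provable now; size M. -/
def Stmt.stub_pdcPerThree : Prop :=
  Literature.Computability.AlgebraicComplexity.detProjectionComplexity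
      (Literature.Computability.AlgebraicComplexity.perPoly (Fin 3) ℂ) = 7

/-- STUB 1@3 — ACYCLIC NORMAL FORM AT `n = 3`: every `7 × 7` Valiant projection `A` with `det A = per_3` is
`DetReprEquivalent (permSymmetrySubst ℂ 3)`-equivalent to a `7 × 7` projection `N` with `det N = per_3` in
acyclic form (`N i j = 0` for `0 < j < i`, constant loops `N i i` for `0 < i`).  Open; decidable by computation. -/
def Stmt.stub_acyclicNormalFormThree : Prop :=
  ∀ A : Matrix (Fin 7) (Fin 7) (MvPolynomial (Fin 3 × Fin 3) ℂ),
    (∀ i j, (∃ v, A i j = MvPolynomial.X v) ∨ ∃ c, A i j = MvPolynomial.C c) →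
    A.det = Literature.Computability.AlgebraicComplexity.perPoly (Fin 3) ℂ →
    ∃ N : Matrix (Fin 7) (Fin 7) (MvPolynomial (Fin 3 × Fin 3) ℂ),
      (∀ i j, (∃ v, N i j = MvPolynomial.X v) ∨ ∃ c, N i j = MvPolynomial.C c) ∧
      N.det = Literature.Computability.AlgebraicComplexity.perPoly (Fin 3) ℂ ∧
      (∀ i j, 0 < Fin.val j → Fin.val j < Fin.val i → N i j = 0) ∧
      (∀ i, 0 < Fin.val i → ∃ c, N i i = MvPolynomial.C c) ∧
      Literature.Computability.AlgebraicComplexity.DetReprEquivalent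
        (Literature.Computability.AlgebraicComplexity.permSymmetrySubst ℂ 3) A N

/-- STUB TL@3 — TWO-LINE LEMMA (structure of ALL `7 × 7` affine representations of `per_3`; PROVABLE NOW,
proved by the lead, reshape r2): for `A` affine with `det A = per_3` and any null vectors `u` (left), `w` (right)
of `A(0)`, there is a line of the `3 × 3` grid (row `r` or column `r`) on whose variables the border forms
`Σ_i u_i A_{ij}`, `Σ_j w_j A_{ij}` have no coefficient (ABV's `V(I)` is a line space: equality case of
ABV Cor. 1.4 + classification of `3`-dim linear subspaces of `Sing(per_3)`).  First step of every approach to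
rigidity at `n = 3` (lead EVIDENCE-n3.md §1, worker anf3 T1). -/
def Stmt.stub_twoLineThree : Prop :=
  ∀ A : Matrix (Fin 7) (Fin 7) (MvPolynomial (Fin 3 × Fin 3) ℂ),
    (∀ i j, (A i j).totalDegree ≤ 1) →
    A.det = Literature.Computability.AlgebraicComplexity.perPoly (Fin 3) ℂ →
    ∀ u w : Fin 7 → ℂ,
      Matrix.vecMul u (A.map MvPolynomial.constantCoeff) = 0 →
      Matrix.mulVec (A.map MvPolynomial.constantCoeff) w = 0 →
      ∃ (isRow : Bool) (r : Fin 3), ∀ v : Fin 3 × Fin 3, (if isRow then v.1 = r else v.2 = r) →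
      (∀ j, MvPolynomial.coeff (Finsupp.single v 1) (∑ i, u i • A i j) = 0) ∧
      (∀ i, MvPolynomial.coeff (Finsupp.single v 1) (∑ j, w j • A i j) = 0)

/-- STUB PV@3 — PIVOT LEMMA (structure of ALL `7 × 7` affine representations of `per_3`; PROVABLE NOW, proved
by the lead, reshape r3): if `det A = per_3` and `A_{ww} = c ≠ 0` is constant, then row `w` and column `w` each
contain a non-constant off-diagonal entry (else the Schur complement of the pivot is a `6 × 6` affine
representation, contradicting `dc(per_3) = 7`).  For acyclic-form projections: every internal vertex has a
VARIABLE in-arc and a VARIABLE out-arc (lead EVIDENCE-n3.md §1 (S5c)). -/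
def Stmt.stub_pivotThree : Prop :=
  ∀ A : Matrix (Fin 7) (Fin 7) (MvPolynomial (Fin 3 × Fin 3) ℂ),
    (∀ i j, (A i j).totalDegree ≤ 1) →
    A.det = Literature.Computability.AlgebraicComplexity.perPoly (Fin 3) ℂ →
    ∀ (w : Fin 7) (c : ℂ), c ≠ 0 → A w w = MvPolynomial.C c →
      (∃ j, j ≠ w ∧ ∀ d : ℂ, A w j ≠ MvPolynomial.C d) ∧
      (∃ i, i ≠ w ∧ ∀ d : ℂ, A i w ≠ MvPolynomial.C d)

/-- STUB 2@3'' — NISAN LAYER-UNIQUENESS AT `n = 3` GIVEN THE STRUCTURE LEMMAS (held by the lead; open,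
decidable by computation): assuming `Stmt.stub_twoLineThree` and `Stmt.stub_pivotThree` (theorems, landed
separately), any two `7 × 7` Valiant projections `N, N'` with `det = per_3`, BOTH in acyclic form, are
`DetReprEquivalent (permSymmetrySubst ℂ 3)`-equivalent.  Logically the rigidity stub of r1 with its two structural
inputs made explicit; HI16 Prop. 9 is the `0/1`-constant case. -/
def Stmt.stub_nisanLayerUniqueThree_of_structure : Prop :=
  (∀ A : Matrix (Fin 7) (Fin 7) (MvPolynomial (Fin 3 × Fin 3) ℂ),
      (∀ i j, (A i j).totalDegree ≤ 1) →
      A.det = Literature.Computability.AlgebraicComplexity.perPoly (Fin 3) ℂ →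
      ∀ u w : Fin 7 → ℂ,
        Matrix.vecMul u (A.map MvPolynomial.constantCoeff) = 0 →
        Matrix.mulVec (A.map MvPolynomial.constantCoeff) w = 0 →
        ∃ (isRow : Bool) (r : Fin 3), ∀ v : Fin 3 × Fin 3, (if isRow then v.1 = r else v.2 = r) →
          (∀ j, MvPolynomial.coeff (Finsupp.single v 1) (∑ i, u i • A i j) = 0) ∧
          (∀ i, MvPolynomial.coeff (Finsupp.single v 1) (∑ j, w j • A i j) = 0)) →
  (∀ A : Matrix (Fin 7) (Fin 7) (MvPolynomial (Fin 3 × Fin 3) ℂ),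
      (∀ i j, (A i j).totalDegree ≤ 1) →
      A.det = Literature.Computability.AlgebraicComplexity.perPoly (Fin 3) ℂ →
      ∀ (w : Fin 7) (c : ℂ), c ≠ 0 → A w w = MvPolynomial.C c →
        (∃ j, j ≠ w ∧ ∀ d : ℂ, A w j ≠ MvPolynomial.C d) ∧
        (∃ i, i ≠ w ∧ ∀ d : ℂ, A i w ≠ MvPolynomial.C d)) →
    ∀ N N' : Matrix (Fin 7) (Fin 7) (MvPolynomial (Fin 3 × Fin 3) ℂ),
      (∀ i j, (∃ v, N i j = MvPolynomial.X v) ∨ ∃ c, N i j = MvPolynomial.C c) →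
      (∀ i j, (∃ v, N' i j = MvPolynomial.X v) ∨ ∃ c, N' i j = MvPolynomial.C c) →
      N.det = Literature.Computability.AlgebraicComplexity.perPoly (Fin 3) ℂ →
      N'.det = Literature.Computability.AlgebraicComplexity.perPoly (Fin 3) ℂ →
      (∀ i j, 0 < Fin.val j → Fin.val j < Fin.val i → N i j = 0) →
      (∀ i, 0 < Fin.val i → ∃ c, N i i = MvPolynomial.C c) →
      (∀ i j, 0 < Fin.val j → Fin.val j < Fin.val i → N' i j = 0) →
      (∀ i, 0 < Fin.val i → ∃ c, N' i i = MvPolynomial.C c) →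
      Literature.Computability.AlgebraicComplexity.DetReprEquivalent
        (Literature.Computability.AlgebraicComplexity.permSymmetrySubst ℂ 3) N N'

/-- STUB 1 — ACYCLIC (branching-program) NORMAL FORM for `n ≥ 4` (`ProjAcyclicNormalForm` of the route's
two-layer plan, birth statement with the range cut to `n ≥ 4`).  For `n ≥ 4`, every Valiant projection `A` of
`DET_m`, `m = pdc(per_n)`, with `det A = per_n` is equivalent under constant gauge × `permSymmetrySubst ℂ n` ×
transpose (`DetReprEquivalent`) to a projection `N` with `det N = per_n` in acyclic form.  Open; size L–XL. -/
def Stmt.stub_acyclicNormalForm : Prop :=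
  ∀ n ≥ 4, ∀ A : Matrix
      (Fin (Literature.Computability.AlgebraicComplexity.detProjectionComplexity
        (Literature.Computability.AlgebraicComplexity.perPoly (Fin n) ℂ)))
      (Fin (Literature.Computability.AlgebraicComplexity.detProjectionComplexity
        (Literature.Computability.AlgebraicComplexity.perPoly (Fin n) ℂ)))
      (MvPolynomial (Fin n × Fin n) ℂ),
    (∀ i j, (∃ v, A i j = MvPolynomial.X v) ∨ ∃ c, A i j = MvPolynomial.C c) →
    A.det = Literature.Computability.AlgebraicComplexity.perPoly (Fin n) ℂ →
    ∃ N : Matrix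
        (Fin (Literature.Computability.AlgebraicComplexity.detProjectionComplexity
          (Literature.Computability.AlgebraicComplexity.perPoly (Fin n) ℂ)))
        (Fin (Literature.Computability.AlgebraicComplexity.detProjectionComplexity
          (Literature.Computability.AlgebraicComplexity.perPoly (Fin n) ℂ)))
        (MvPolynomial (Fin n × Fin n) ℂ),
      (∀ i j, (∃ v, N i j = MvPolynomial.X v) ∨ ∃ c, N i j = MvPolynomial.C c) ∧
      N.det = Literature.Computability.AlgebraicComplexity.perPoly (Fin n) ℂ ∧
      (∀ i j, 0 < Fin.val j → Fin.val j < Fin.val i → N i j = 0) ∧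
      (∀ i, 0 < Fin.val i → ∃ c, N i i = MvPolynomial.C c) ∧
      Literature.Computability.AlgebraicComplexity.DetReprEquivalent
        (Literature.Computability.AlgebraicComplexity.permSymmetrySubst ℂ n) A N

/-- STUB 2 — NISAN LAYER-UNIQUENESS for `n ≥ 4` (`NisanCommutative` of the route's two-layer plan, birth
statement with the range cut to `n ≥ 4`; the hardest stub).  For `n ≥ 4`, any two Valiant projections
`N, N'` of `DET_m`, `m = pdc(per_n)`, with `det = per_n`, BOTH in acyclic form, are
`DetReprEquivalent (permSymmetrySubst ℂ n)`-equivalent.  Open; size XL. -/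
def Stmt.stub_nisanLayerUnique : Prop :=
  ∀ n ≥ 4, ∀ N N' : Matrix
      (Fin (Literature.Computability.AlgebraicComplexity.detProjectionComplexity
        (Literature.Computability.AlgebraicComplexity.perPoly (Fin n) ℂ)))
      (Fin (Literature.Computability.AlgebraicComplexity.detProjectionComplexity
        (Literature.Computability.AlgebraicComplexity.perPoly (Fin n) ℂ)))
      (MvPolynomial (Fin n × Fin n) ℂ),
    (∀ i j, (∃ v, N i j = MvPolynomial.X v) ∨ ∃ c, N i j = MvPolynomial.C c) →
    (∀ i j, (∃ v, N' i j = MvPolynomial.X v) ∨ ∃ c, N' i j = MvPolynomial.C c) →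
    N.det = Literature.Computability.AlgebraicComplexity.perPoly (Fin n) ℂ →
    N'.det = Literature.Computability.AlgebraicComplexity.perPoly (Fin n) ℂ →
    (∀ i j, 0 < Fin.val j → Fin.val j < Fin.val i → N i j = 0) →
    (∀ i, 0 < Fin.val i → ∃ c, N i i = MvPolynomial.C c) →
    (∀ i j, 0 < Fin.val j → Fin.val j < Fin.val i → N' i j = 0) →
    (∀ i, 0 < Fin.val i → ∃ c, N' i i = MvPolynomial.C c) →
    Literature.Computability.AlgebraicComplexity.DetReprEquivalent
      (Literature.Computability.AlgebraicComplexity.permSymmetrySubst ℂ n) N N'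

/-! ## Registered stubs (the ONLY sorries of this file; stub 0 is closed) -/

/-- Registered stub 0 = `Stmt.stub_pdcPerThree` (`pdc(per_3) = 7`) — CLOSED: landed as
`Theorems/ProjectionRigidityProjOptimalUniqueStubPdcPerThree.lean` (p147258, wave 1). -/
theorem stub_pdcPerThree :
    Literature.Computability.AlgebraicComplexity.detProjectionComplexity
      (Literature.Computability.AlgebraicComplexity.perPoly (Fin 3) ℂ) = 7 :=
  Summit.ValiantsHypothesis.ValiantsHypothesis.Theorems.ProjectionRigidityProjOptimalUnique.stub_pdcPerThree

/-- Registered stub 1@3 = `Stmt.stub_acyclicNormalFormThree` (every `7 × 7` projection of `per_3` is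
equivalent to an acyclic-form projection with the same determinant). -/
theorem stub_acyclicNormalFormThree :
    ∀ A : Matrix (Fin 7) (Fin 7) (MvPolynomial (Fin 3 × Fin 3) ℂ),
      (∀ i j, (∃ v, A i j = MvPolynomial.X v) ∨ ∃ c, A i j = MvPolynomial.C c) →
      A.det = Literature.Computability.AlgebraicComplexity.perPoly (Fin 3) ℂ →
      ∃ N : Matrix (Fin 7) (Fin 7) (MvPolynomial (Fin 3 × Fin 3) ℂ),
        (∀ i j, (∃ v, N i j = MvPolynomial.X v) ∨ ∃ c, N i j = MvPolynomial.C c) ∧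
        N.det = Literature.Computability.AlgebraicComplexity.perPoly (Fin 3) ℂ ∧
        (∀ i j, 0 < Fin.val j → Fin.val j < Fin.val i → N i j = 0) ∧
        (∀ i, 0 < Fin.val i → ∃ c, N i i = MvPolynomial.C c) ∧
        Literature.Computability.AlgebraicComplexity.DetReprEquivalent
          (Literature.Computability.AlgebraicComplexity.permSymmetrySubst ℂ 3) A N := by
  sorry

/-- Registered stub TL@3 = `Stmt.stub_twoLineThree` (two-line lemma) — CLOSED: landed as
`Theorems/ProjectionRigidityProjOptimalUniqueStubTwoLineThree.lean` (p150621). -/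
theorem stub_twoLineThree :
    ∀ A : Matrix (Fin 7) (Fin 7) (MvPolynomial (Fin 3 × Fin 3) ℂ),
      (∀ i j, (A i j).totalDegree ≤ 1) →
      A.det = Literature.Computability.AlgebraicComplexity.perPoly (Fin 3) ℂ →
      ∀ u w : Fin 7 → ℂ,
        Matrix.vecMul u (A.map MvPolynomial.constantCoeff) = 0 →
        Matrix.mulVec (A.map MvPolynomial.constantCoeff) w = 0 →
        ∃ (isRow : Bool) (r : Fin 3), ∀ v : Fin 3 × Fin 3, (if isRow then v.1 = r else v.2 = r) →
          (∀ j, MvPolynomial.coeff (Finsupp.single v 1) (∑ i, u i • A i j) = 0) ∧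
          (∀ i, MvPolynomial.coeff (Finsupp.single v 1) (∑ j, w j • A i j) = 0) :=
  Summit.ValiantsHypothesis.ValiantsHypothesis.Theorems.ProjectionRigidityProjOptimalUnique.stub_twoLineThree

/-- Registered stub PV@3 = `Stmt.stub_pivotThree` (pivot lemma) — CLOSED: landed as
`Theorems/ProjectionRigidityProjOptimalUniqueStubPivotThree.lean` (p149817). -/
theorem stub_pivotThree :
    ∀ A : Matrix (Fin 7) (Fin 7) (MvPolynomial (Fin 3 × Fin 3) ℂ),
      (∀ i j, (A i j).totalDegree ≤ 1) →
      A.det = Literature.Computability.AlgebraicComplexity.perPoly (Fin 3) ℂ →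
      ∀ (w : Fin 7) (c : ℂ), c ≠ 0 → A w w = MvPolynomial.C c →
        (∃ j, j ≠ w ∧ ∀ d : ℂ, A w j ≠ MvPolynomial.C d) ∧
        (∃ i, i ≠ w ∧ ∀ d : ℂ, A i w ≠ MvPolynomial.C d) :=
  Summit.ValiantsHypothesis.ValiantsHypothesis.Theorems.ProjectionRigidityProjOptimalUnique.stub_pivotThree

/-- Registered stub 2@3'' = `Stmt.stub_nisanLayerUniqueThree_of_structure` (rigidity inside acyclic form at
`n = 3`, given the two-line and pivot lemmas). -/
theorem stub_nisanLayerUniqueThree_of_structure :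
    (∀ A : Matrix (Fin 7) (Fin 7) (MvPolynomial (Fin 3 × Fin 3) ℂ),
      (∀ i j, (A i j).totalDegree ≤ 1) →
      A.det = Literature.Computability.AlgebraicComplexity.perPoly (Fin 3) ℂ →
      ∀ u w : Fin 7 → ℂ,
        Matrix.vecMul u (A.map MvPolynomial.constantCoeff) = 0 →
        Matrix.mulVec (A.map MvPolynomial.constantCoeff) w = 0 →
        ∃ (isRow : Bool) (r : Fin 3), ∀ v : Fin 3 × Fin 3, (if isRow then v.1 = r else v.2 = r) →
          (∀ j, MvPolynomial.coeff (Finsupp.single v 1) (∑ i, u i • A i j) = 0) ∧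
          (∀ i, MvPolynomial.coeff (Finsupp.single v 1) (∑ j, w j • A i j) = 0)) →
    (∀ A : Matrix (Fin 7) (Fin 7) (MvPolynomial (Fin 3 × Fin 3) ℂ),
      (∀ i j, (A i j).totalDegree ≤ 1) →
      A.det = Literature.Computability.AlgebraicComplexity.perPoly (Fin 3) ℂ →
      ∀ (w : Fin 7) (c : ℂ), c ≠ 0 → A w w = MvPolynomial.C c →
        (∃ j, j ≠ w ∧ ∀ d : ℂ, A w j ≠ MvPolynomial.C d) ∧
        (∃ i, i ≠ w ∧ ∀ d : ℂ, A i w ≠ MvPolynomial.C d)) →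
    ∀ N N' : Matrix (Fin 7) (Fin 7) (MvPolynomial (Fin 3 × Fin 3) ℂ),
      (∀ i j, (∃ v, N i j = MvPolynomial.X v) ∨ ∃ c, N i j = MvPolynomial.C c) →
      (∀ i j, (∃ v, N' i j = MvPolynomial.X v) ∨ ∃ c, N' i j = MvPolynomial.C c) →
      N.det = Literature.Computability.AlgebraicComplexity.perPoly (Fin 3) ℂ →
      N'.det = Literature.Computability.AlgebraicComplexity.perPoly (Fin 3) ℂ →
      (∀ i j, 0 < Fin.val j → Fin.val j < Fin.val i → N i j = 0) →
      (∀ i, 0 < Fin.val i → ∃ c, N i i = MvPolynomial.C c) →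
      (∀ i j, 0 < Fin.val j → Fin.val j < Fin.val i → N' i j = 0) →
      (∀ i, 0 < Fin.val i → ∃ c, N' i i = MvPolynomial.C c) →
      Literature.Computability.AlgebraicComplexity.DetReprEquivalent
        (Literature.Computability.AlgebraicComplexity.permSymmetrySubst ℂ 3) N N' := by
  sorry

/-- Registered stub 1 = `Stmt.stub_acyclicNormalForm` (for `n ≥ 4`, every optimal projection of `per_n` is
equivalent to an acyclic-form projection with the same determinant). -/
theorem stub_acyclicNormalForm :
    ∀ n ≥ 4, ∀ A : Matrix
        (Fin (Literature.Computability.AlgebraicComplexity.detProjectionComplexity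
          (Literature.Computability.AlgebraicComplexity.perPoly (Fin n) ℂ)))
        (Fin (Literature.Computability.AlgebraicComplexity.detProjectionComplexity
          (Literature.Computability.AlgebraicComplexity.perPoly (Fin n) ℂ)))
        (MvPolynomial (Fin n × Fin n) ℂ),
      (∀ i j, (∃ v, A i j = MvPolynomial.X v) ∨ ∃ c, A i j = MvPolynomial.C c) →
      A.det = Literature.Computability.AlgebraicComplexity.perPoly (Fin n) ℂ →
      ∃ N : Matrix
          (Fin (Literature.Computability.AlgebraicComplexity.detProjectionComplexity
            (Literature.Computability.AlgebraicComplexity.perPoly (Fin n) ℂ)))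
          (Fin (Literature.Computability.AlgebraicComplexity.detProjectionComplexity
            (Literature.Computability.AlgebraicComplexity.perPoly (Fin n) ℂ)))
          (MvPolynomial (Fin n × Fin n) ℂ),
        (∀ i j, (∃ v, N i j = MvPolynomial.X v) ∨ ∃ c, N i j = MvPolynomial.C c) ∧
        N.det = Literature.Computability.AlgebraicComplexity.perPoly (Fin n) ℂ ∧
        (∀ i j, 0 < Fin.val j → Fin.val j < Fin.val i → N i j = 0) ∧
        (∀ i, 0 < Fin.val i → ∃ c, N i i = MvPolynomial.C c) ∧
        Literature.Computability.AlgebraicComplexity.DetReprEquivalent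
          (Literature.Computability.AlgebraicComplexity.permSymmetrySubst ℂ n) A N := by
  sorry

/-- Registered stub 2 = `Stmt.stub_nisanLayerUnique` (for `n ≥ 4`, two acyclic-form optimal projections of
`per_n` with `det = per_n` are equivalent under constant gauge × `permSymmetrySubst` × transpose). -/
theorem stub_nisanLayerUnique :
    ∀ n ≥ 4, ∀ N N' : Matrix
        (Fin (Literature.Computability.AlgebraicComplexity.detProjectionComplexity
          (Literature.Computability.AlgebraicComplexity.perPoly (Fin n) ℂ)))
        (Fin (Literature.Computability.AlgebraicComplexity.detProjectionComplexity
          (Literature.Computability.AlgebraicComplexity.perPoly (Fin n) ℂ)))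
        (MvPolynomial (Fin n × Fin n) ℂ),
      (∀ i j, (∃ v, N i j = MvPolynomial.X v) ∨ ∃ c, N i j = MvPolynomial.C c) →
      (∀ i j, (∃ v, N' i j = MvPolynomial.X v) ∨ ∃ c, N' i j = MvPolynomial.C c) →
      N.det = Literature.Computability.AlgebraicComplexity.perPoly (Fin n) ℂ →
      N'.det = Literature.Computability.AlgebraicComplexity.perPoly (Fin n) ℂ →
      (∀ i j, 0 < Fin.val j → Fin.val j < Fin.val i → N i j = 0) →
      (∀ i, 0 < Fin.val i → ∃ c, N i i = MvPolynomial.C c) →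
      (∀ i j, 0 < Fin.val j → Fin.val j < Fin.val i → N' i j = 0) →
      (∀ i, 0 < Fin.val i → ∃ c, N' i i = MvPolynomial.C c) →
      Literature.Computability.AlgebraicComplexity.DetReprEquivalent
        (Literature.Computability.AlgebraicComplexity.permSymmetrySubst ℂ n) N N' := by
  sorry

/-! ## The composition (kernel-checked, sorry-free) -/

/-- **The crux from the five stubs.**  Case `n = 3`: the anchor `pdc(per_3) = 7` turns the matrices of size
`Fin (pdc per_3)` into honest `7 × 7` matrices (`generalize` + `subst`), then normal form + rigidity at
`n = 3` and the equivalence-relation algebra of `DetReprEquivalent` give `A ~ N ~ N' ~ B`.  Case `n ≥ 4`: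
the same chain with the `n ≥ 4` stubs.  The crux's conclusion is `DetReprEquivalent … A B` by `rfl`-unfolding. -/
theorem ProjOptimalUnique_of :
    Stmt.stub_pdcPerThree → Stmt.stub_acyclicNormalFormThree → Stmt.stub_twoLineThree →
    Stmt.stub_pivotThree → Stmt.stub_nisanLayerUniqueThree_of_structure →
    Stmt.stub_acyclicNormalForm → Stmt.stub_nisanLayerUnique →
      Summit.ValiantsHypothesis.ValiantsHypothesis.Theses.ProjectionRigidity.ProjOptimalUnique := by
  intro h₀ h₁ hTL hPV h₂' h₃ h₄
  unfold Stmt.stub_pdcPerThree at h₀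
  unfold Stmt.stub_acyclicNormalFormThree at h₁
  unfold Stmt.stub_twoLineThree at hTL
  unfold Stmt.stub_pivotThree at hPV
  unfold Stmt.stub_nisanLayerUniqueThree_of_structure at h₂'
  have h₂ := h₂' hTL hPV
  unfold Stmt.stub_acyclicNormalForm at h₃
  unfold Stmt.stub_nisanLayerUnique at h₄
  unfold Summit.ValiantsHypothesis.ValiantsHypothesis.Theses.ProjectionRigidity.ProjOptimalUnique
  intro n hn
  rcases Nat.lt_or_ge n 4 with hlt | hge
  · -- `n = 3`: transport to `Fin 7` along the anchor
    obtain rfl : n = 3 := by omega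
    generalize Literature.Computability.AlgebraicComplexity.detProjectionComplexity
        (Literature.Computability.AlgebraicComplexity.perPoly (Fin 3) ℂ) = m at h₀ ⊢
    subst h₀
    intro A B hA hB hdA hdB
    obtain ⟨N, hN, hNdet, hNlow, hNdiag, hAN⟩ := h₁ A hA hdA
    obtain ⟨N', hN', hN'det, hN'low, hN'diag, hBN'⟩ := h₁ B hB hdB
    have hNN' :
        Literature.Computability.AlgebraicComplexity.DetReprEquivalent
          (Literature.Computability.AlgebraicComplexity.permSymmetrySubst ℂ 3) N N' :=
      h₂ N N' hN hN' hNdet hN'det hNlow hNdiag hN'low hN'diag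
    exact hAN.trans (hNN'.trans hBN'.symm)
  · -- `n ≥ 4`: the birth chain
    intro A B hA hB hdA hdB
    obtain ⟨N, hN, hNdet, hNlow, hNdiag, hAN⟩ := h₃ n hge A hA hdA
    obtain ⟨N', hN', hN'det, hN'low, hN'diag, hBN'⟩ := h₃ n hge B hB hdB
    have hNN' :
        Literature.Computability.AlgebraicComplexity.DetReprEquivalent
          (Literature.Computability.AlgebraicComplexity.permSymmetrySubst ℂ n) N N' :=
      h₄ n hge N N' hN hN' hNdet hN'det hNlow hNdiag hN'low hN'diag
    exact hAN.trans (hNN'.trans hBN'.symm)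

/-- THE SKELETON: the crux, modulo exactly the seven registered stubs (stub 0 closed) (compile-checks that the `Stmt` copies
and the stub statements agree). -/
theorem ProjOptimalUnique_proof :
    Summit.ValiantsHypothesis.ValiantsHypothesis.Theses.ProjectionRigidity.ProjOptimalUnique :=
  ProjOptimalUnique_of stub_pdcPerThree stub_acyclicNormalFormThree stub_twoLineThree stub_pivotThree
    stub_nisanLayerUniqueThree_of_structure stub_acyclicNormalForm stub_nisanLayerUnique

end

end Summit.ValiantsHypothesis.ValiantsHypothesis.Cruxes.ProjOptimalUnique.Birth
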